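import Mathlib
import Summits.Ventures.HodgeRepro0.P7Certificate

/-!
# P7CertificateZeta15Sevenfold — the finite arithmetic behind instance I-7 (P7-InstanceTable.md v2.4): the 4+2+1 sevenfold
`B₂ × B₁ × E` in `ℚ(ζ₁₅)`

Setting (paper side): `L = ℚ(ζ₁₅)`, `Gal(L/ℚ) = (ℤ/15)ˣ`, conjugation `14`. `B₂` = the simple CM fourfold with CM by `L`,
type `Φ₂ = {1,2,4,7}`; `B₁` = the simple CM surface with CM by `ℚ(ζ₅) = L^{⟨11⟩}`, type `Φ₁ = {1,2} ⊂ (ℤ/5)ˣ`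
(restriction `a ↦ a mod 5`); `E` = the elliptic curve with CM by `ℚ(√−3) = L^{⟨4⟩}` (`⟨4⟩ = {1,4,7,13} = {a ≡ 1 mod 3}`),
type `Φ_E = {1} ⊂ (ℤ/3)ˣ` (restriction `a ↦ a mod 3`). Witness `Δ = ({1,7} ⊂ Σ_{B₂}) ⊔ ({4} ⊂ Σ_{B₁}) ⊔ ({2} ⊂ Σ_E)`,
indexing a class in `H²(B₂) ⊗ H¹(B₁) ⊗ H¹(E) ⊂ H⁴(B₂ × B₁ × E)` — the (2,8) family of P2-ResidualCensus §E.

Certified (`decide`, standard axioms): the three CM types; `Δ_hodge` (balance over all 8 `τ`: `e_Δ` is a Hodge class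
of type (2,2)); `orbit_card` (8) and `stab` (trivial: the orbit field is `L` itself, octic); `no_hodge_pair`;
`χ_sum_ΔB₁` (the order-4 character `χ`, `χ(2) = i`, `χ(11) = 1`, evaluated on the `B₁`-part of `Δ` gives `χ(4) = −1 ≠ 0`)
with `χ_pair` and `χ_coset` (vanishing on conjugate pairs and on the cosets of the two index-2 subgroups not containing 14)
— by Lemma 2.2 / Cor 2.3 of p7-minimal-instances.md the orbit piece is outside the algebra generated by divisor classes and
imaginary-quadratic Weil classes on all powers (type U). On the other hand every factor is of Fermat type of degree 15
(`B₂`: Φ_{(1,1,13)}; `B₁`: degree 5; `E`: the Fermat cubic), so Shioda 1981 Thm 4.4 (m ≤ 20) makes this realisation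
ALGEBRAIC: the Fermat cycles are not Weil-generated (second cross-check). Paper side not formalised.
-/

namespace HodgeRepro0.P7CertificateZeta15Sevenfold

open Finset

/-- Units of `ℤ/15` (from the accepted file `P7Certificate`). -/
abbrev U15 : Finset (ZMod 15) := HodgeRepro0.P7Certificate.U15

/-- Restriction to `Gal(ℚ(ζ₅)/ℚ) = (ℤ/5)ˣ` (from `P7Certificate`). -/
abbrev res5 (a : ZMod 15) : ZMod 5 := HodgeRepro0.P7Certificate.res a

/-- Restriction to `Gal(ℚ(√−3)/ℚ) = (ℤ/3)ˣ`. -/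
def res3 (a : ZMod 15) : ZMod 3 := (a.val : ZMod 3)

/-- CM types. -/
def Φ₂ : Finset (ZMod 15) := {1, 2, 4, 7}

/-- CM type of `B₁`. -/
def Φ₁ : Finset (ZMod 5) := {1, 2}

/-- CM type of `E`. -/
def ΦE : Finset (ZMod 3) := {1}

/-- The parts of `Δ`. -/
def Δ₂ : Finset (ZMod 15) := {1, 7}

/-- `B₁`-part of `Δ`. -/
def Δ₁ : Finset (ZMod 5) := {4}

/-- `E`-part of `Δ`. -/
def ΔE : Finset (ZMod 3) := {2}

/-- The three CM types. -/
theorem cmTypes : (∀ x ∈ U15, (x ∈ Φ₂ ↔ -x ∉ Φ₂)) ∧ (∀ x : ZMod 5, x ≠ 0 → (x ∈ Φ₁ ↔ -x ∉ Φ₁)) ∧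
    (∀ x : ZMod 3, x ≠ 0 → (x ∈ ΦE ↔ -x ∉ ΦE)) := by decide

/-- `|Δ ∩ τΦ|` for the three slots. -/
def cnt (S₂ : Finset (ZMod 15)) (S₁ : Finset (ZMod 5)) (SE : Finset (ZMod 3)) (τ : ZMod 15) : ℕ :=
  (S₂ ∩ Φ₂.image (· * τ)).card + (S₁ ∩ Φ₁.image (· * res5 τ)).card + (SE ∩ ΦE.image (· * res3 τ)).card

/-- Balance condition. -/
def IsHodgeSet (S₂ : Finset (ZMod 15)) (S₁ : Finset (ZMod 5)) (SE : Finset (ZMod 3)) : Prop :=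
  ∀ τ ∈ U15, 2 * cnt S₂ S₁ SE τ = S₂.card + S₁.card + SE.card

/-- Decidability. -/
instance (S₂ : Finset (ZMod 15)) (S₁ : Finset (ZMod 5)) (SE : Finset (ZMod 3)) : Decidable (IsHodgeSet S₂ S₁ SE) := by
  unfold IsHodgeSet; infer_instance

/-- `e_Δ` is a Hodge class of type (2,2). -/
theorem Δ_hodge : IsHodgeSet Δ₂ Δ₁ ΔE := by decide

/-- The Galois orbit of `Δ` has 8 elements (orbit field `L`, octic). -/
theorem orbit_card :
    (U15.image (fun τ => (Δ₂.image (· * τ), Δ₁.image (· * res5 τ), ΔE.image (· * res3 τ)))).card = 8 := by decide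

/-- The stabiliser of `Δ` is trivial. -/
theorem stab :
    U15.filter (fun τ => Δ₂.image (· * τ) = Δ₂ ∧ Δ₁.image (· * res5 τ) = Δ₁ ∧ ΔE.image (· * res3 τ) = ΔE) = {1} := by
  decide

/-- No 2-element subset of `Δ` is balanced (the six pairs). -/
theorem no_hodge_pair :
    ¬ IsHodgeSet Δ₂ ∅ ∅ ∧ ¬ IsHodgeSet {1} Δ₁ ∅ ∧ ¬ IsHodgeSet {7} Δ₁ ∅ ∧
    ¬ IsHodgeSet {1} ∅ ΔE ∧ ¬ IsHodgeSet {7} ∅ ΔE ∧ ¬ IsHodgeSet ∅ Δ₁ ΔE := by decide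

/-- The order-4 character on `(ℤ/5)ˣ` (from `P7Certificate`): `χ(1) = 1, χ(2) = i, χ(4) = −1, χ(3) = −i`. -/
abbrev χ5 (x : ZMod 5) : GaussianInt := HodgeRepro0.P7Certificate.χ5 x

/-- Pulled back to `(ℤ/15)ˣ` (from `P7Certificate`). -/
abbrev χ (a : ZMod 15) : GaussianInt := HodgeRepro0.P7Certificate.χ a

/-- The certificate value on the `B₁`-part of `Δ`: `χ(4) = −1 ≠ 0`. -/
theorem χ_sum_ΔB₁ : Δ₁.sum χ5 = -1 ∧ Δ₁.sum χ5 ≠ 0 := by decide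

/-- `χ` kills conjugate pairs. -/
theorem χ_pair : ∀ x : ZMod 5, x ≠ 0 → χ5 x + χ5 (-x) = 0 := by decide

/-- `χ` kills every coset of the two index-2 subgroups of `(ℤ/15)ˣ` not containing 14. -/
theorem χ_coset : ∀ H ∈ ({({1, 2, 4, 8} : Finset (ZMod 15)), {1, 4, 7, 13}} : Finset (Finset (ZMod 15))),
    ∀ y ∈ U15, (H.image (· * y)).sum χ = 0 := HodgeRepro0.P7Certificate.χ_coset'

/-- Packaged certificate for I-7 (ζ₁₅ realisation). -/
theorem certificate :
    IsHodgeSet Δ₂ Δ₁ ΔE ∧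
    (U15.image (fun τ => (Δ₂.image (· * τ), Δ₁.image (· * res5 τ), ΔE.image (· * res3 τ)))).card = 8 ∧
    Δ₁.sum χ5 ≠ 0 ∧ (∀ x : ZMod 5, x ≠ 0 → χ5 x + χ5 (-x) = 0) ∧
    (∀ H ∈ ({({1, 2, 4, 8} : Finset (ZMod 15)), {1, 4, 7, 13}} : Finset (Finset (ZMod 15))),
      ∀ y ∈ U15, (H.image (· * y)).sum χ = 0) :=
  ⟨Δ_hodge, orbit_card, χ_sum_ΔB₁.2, χ_pair, χ_coset⟩

end HodgeRepro0.P7CertificateZeta15Sevenfold
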